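/-
Copyright: lit-balaban Phase-2 proof seat p30 (gen 9).  Statement-level skeleton of a published paper; no proof claims beyond what
the kernel checks below.
-/
import Literature.MathematicalPhysics.QuantumFieldTheory.BalabanImbrieJaffe1984to88.BIJ85Eq454PlaqResidual
import Literature.MathematicalPhysics.QuantumFieldTheory.BalabanImbrieJaffe1984to88.BIJ85Thm711TorusTransport
import Literature.MathematicalPhysics.QuantumFieldTheory.BalabanImbrieJaffe1984to88.BIJ85Eq5113Proof
import Literature.MathematicalPhysics.QuantumFieldTheory.Balaban1983to89.B5Eq118OneStroke

/-!
# [BalabanImbrieJaffe1985] (4.2.6) on CONSTANT unit fields: `f_k(h) = h^η` exactly — an explicit axial potential for `Q^{e*}_kh − h^η`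

T. Bałaban, J. Imbrie, A. Jaffe, *Renormalization of the Higgs model: minimizers, propagators and the stability of mean field theory*,
Commun. Math. Phys. **97** (1985) 299–329 [BalabanImbrieJaffe1985].  Row **C1.Eq7.3.1-7.3.2** of the lit-balaban skeleton, the residual
link (located input `K_R` of p33's `BIJ85Claim73Residual`): the residual field (4.2.6) `f_k = (I − ∂G_{k,Ax}∂^*)Q^{e*}_kf` (p33's
`BIJ85Eq454PlaqResidual.resE`, Euclidean encoding `resE = √w·f_k`) of a CONSTANT unit plaquette field `f(p′) = h_{μν}` (`p′` of type `(μν)`)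
on the torus `T^{(k)}` IS the constant η-plaquette field with the same values: `f_k(p) = h_{μν}` for every fine plaquette `p` of type `(μν)`.
This is the harmonic (flux) part of the printed gauge choice p. 326 [PDF 28] *"by change of gauge u_k can be transformed in a local region Λ
into a configuration of the form exp[ie_kηA], where A is smooth and small"*: the flux of a unit plaquette field through a coordinate
`2`-torus is carried unchanged to the η-lattice.

THE MECHANISM (p. 311 [PDF 13], (4.2.6)–(4.2.7) and §4.1 p. 309: `∂G_{k,Ax}∂^*` is the orthogonal projection onto `∂V`, `V` the domain
`δ(Q_kA)δ_{k,Ax}(A)` of (4.1.1)).  `Q^{e*}_kh` lives on the junction plaquettes, with the value `L^{2k}h_{μν}` ((2.22) iterated, p33 g6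
`BIJ85Thm711TorusTransport.QestarIter_blockSiteK`); the difference `g := Q^{e*}_kh − h^η` is the curl of the EXPLICIT block-periodic
η-lattice field (block size `n = L^k`, in-block offsets `j = offK`)
`A(x, ν) = Σ_{μ<ν} h_{μν}((n−1)/2 − j_μ(x))`, `A(x, μ) += Σ_{ν>μ} [j_μ(x) = n−1]·h_{μν}·n·(j_ν(x) − (n−1)/2)` (`potK`, `curl_potK`), whose
straight-contour averages over every block vanish (`bondAvgIter_potK`: `Q_kA = 0`, by [12] (1.18) `B5Eq118OneStroke.bondAvgIter_eq_blockSum` and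
the reflection `j ↦ n−1−j` of the block), hence after p36/p37's axial gauge fixing `A + ∂λ(A)` (`BIJ85Eq5113Proof.deltaAx_lamOf`,
`bondAvgIter_add_grad_lamOf`) a member of `V` with curl `g` (`exists_V411_curl_eq`); and `h^η ⊥ ∂A` for every `A` (discrete Stokes on the
torus, `inner_constE_curlOp`).  Therefore the projection of `Q^{e*}_kh` onto `∂V` is `Q^{e*}_kh − h^η` and **`resE(h) = √w·h^η`**
(`resE_const`), so `|f_k(h)(p)| ≤ max|h|` (`abs_resE_const_le`).

WHAT IS PROVED (0 `sorry`, no new named fact; two bookkeeping `def`s with bodies: `offK`, `potK`, plus `constE`; standing range `k ≤ m + K`,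
`2 ≤ d`, `w > 0`, `c ≠ 0`).  statement-level skeleton of published theorems with citation tags; proofs where landed; nothing here is a claim
about the Yang–Mills mass gap.  Unit `lit-balaban-p30` (literature-prover-lit-balaban-p30-g9-0), 2026-08-21.
-/

open scoped BigOperators RealInnerProductSpace

namespace Literature.MathematicalPhysics.QuantumFieldTheory.BalabanImbrieJaffe1984to88.BIJ85ResidualConstants

open Balaban1983to89 hiding Site Plaq
open Balaban1983to89.LatticeFieldCalculus
open Balaban1983to89.B5Eq118OneStroke (iterBlock iterBlockOf val_iterBlockOf bondAvgIter_eq_blockSum)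
open Balaban1983to89.B5Eq117TorusCarriers (blockSiteK val_blockSiteK sum_iterBlock_eq sitesPerDir_zero_eq)
open BIJ85AxialPropagator411 BIJ85Prop521Torus BIJ85Sigma421Torus BIJ85Prop522Torus BIJ85SigmaForm421
open BIJ85Eq531Inputs (QestarIter)
open BIJ85Eq5113Proof (deltaAx_lamOf bondAvgIter_add_grad_lamOf)
open BIJ85GaugeFunction5113 (lamOf)
open BIJ85Thm711TorusTransport (QestarIter_blockSiteK)
open BIJ85Eq454PlaqResidual (resE)
-- inside this namespace the bare `Site`/`Plaq` are the `ℤ^d` carriers of the QFT root; the torus ones are renamed: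
open Balaban1983to89 renaming Site → TSite, Plaq → TPlaq

noncomputable section

variable {P : Params} {k : ℕ}

/-! ## §1  In-block offsets at block size `L^k` -/

/-- The **offset** `j_κ(x) ∈ {0, …, L^k − 1}` of a fine site inside its block of order `k` (label mod `L^k`, [12] (1.18) `B^k(y)`).
[cite: BalabanImbrieJaffe1985, (2.22) p.305] -/
def offK (k : ℕ) (x : TSite P 0) (κ : Fin P.d) : ℕ := (x κ).val % P.L ^ k

/-- Offsets are `< L^k`. [cite: BalabanImbrieJaffe1985, (2.22) p.305] -/
theorem offK_lt (k : ℕ) (x : TSite P 0) (κ : Fin P.d) : offK k x κ < P.L ^ k := Nat.mod_lt _ (pow_pos P.L_pos k)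

/-- The offsets of the block point `L^k·y + j` are `j`. [cite: BalabanImbrieJaffe1985, (2.22) p.305] -/
theorem offK_blockSiteK (hk : k ≤ P.m + P.K) (y : TSite P k) (j : Fin P.d → Fin (P.L ^ k)) (κ : Fin P.d) :
    offK k (blockSiteK k y j) κ = j κ := by
  rw [offK, val_blockSiteK hk, Nat.mul_add_mod_of_lt (j κ).isLt]

/-- Every fine site is the block point of its `k`-fold block and its offsets. [cite: BalabanImbrieJaffe1985, (2.22) p.305] -/
theorem eq_blockSiteK (hk : k ≤ P.m + P.K) (x : TSite P 0) :
    x = blockSiteK k (iterBlockOf k x) (fun κ => ⟨offK k x κ, offK_lt k x κ⟩) := by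
  funext κ
  apply ZMod.val_injective
  rw [val_blockSiteK hk, val_iterBlockOf k hk]
  exact (Nat.div_add_mod' (x κ).val (P.L ^ k)).symm

/-- `L^k` divides the period of the finest torus (standing range). [cite: BalabanImbrieJaffe1985, (2.1) p.304] -/
theorem pow_dvd_sitesPerDir_zero (hk : k ≤ P.m + P.K) : P.L ^ k ∣ P.sitesPerDir 0 :=
  Dvd.intro _ (sitesPerDir_zero_eq hk).symm

/-- Moving `t` steps in direction `κ` adds `t` to the `κ`-offset mod `L^k`. [cite: BalabanImbrieJaffe1985, (2.22) p.305] -/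
theorem offK_runSite_self (hk : k ≤ P.m + P.K) (x : TSite P 0) (κ : Fin P.d) (t : ℕ) :
    offK k (runSite x κ t) κ = (offK k x κ + t) % P.L ^ k := by
  simp only [offK, runSite, Function.update_self]
  rw [ZMod.val_add, ZMod.val_natCast, Nat.mod_mod_of_dvd _ (pow_dvd_sitesPerDir_zero hk), Nat.add_mod,
    Nat.mod_mod_of_dvd _ (pow_dvd_sitesPerDir_zero hk)]
  conv_rhs => rw [Nat.add_mod, Nat.mod_mod]

/-- One step in direction `κ` adds `1` to the `κ`-offset mod `L^k`. [cite: BalabanImbrieJaffe1985, (2.22) p.305] -/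
theorem offK_shift_self (hk : k ≤ P.m + P.K) (x : TSite P 0) (κ : Fin P.d) :
    offK k (x.shift κ) κ = (offK k x κ + 1) % P.L ^ k := by
  have h := offK_runSite_self hk x κ 1
  rwa [show runSite x κ 1 = x.shift κ from by simp [runSite, Balaban1983to89.Site.shift]] at h

/-- Steps in other directions do not change the `κ`-offset. [cite: BalabanImbrieJaffe1985, (2.22) p.305] -/
theorem offK_runSite_of_ne (x : TSite P 0) {κ κ' : Fin P.d} (h : κ ≠ κ') (t : ℕ) :
    offK k (runSite x κ' t) κ = offK k x κ := by
  simp only [offK, runSite, Function.update_of_ne h]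

/-- Steps in other directions do not change the `κ`-offset. [cite: BalabanImbrieJaffe1985, (2.22) p.305] -/
theorem offK_shift_of_ne (x : TSite P 0) {κ κ' : Fin P.d} (h : κ ≠ κ') : offK k (x.shift κ') κ = offK k x κ := by
  simp only [offK, Balaban1983to89.Site.shift, Function.update_of_ne h]

/-- **`Q^{e*}_k` of a unit field in terms of offsets**: `(Q^{e*}_kf)(⟨x, α, β⟩) = L^{2k}f(⟨y, α, β⟩)` if `j_α(x) = j_β(x) = L^k − 1` (`y` the
`k`-fold block point of `x`), `0` otherwise — (2.22) iterated (p33 g6 `QestarIter_blockSiteK`). [cite: BalabanImbrieJaffe1985, (2.22) p.305] -/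
theorem QestarIter_apply_offK (hd : 2 ≤ P.d) (hk : k ≤ P.m + P.K) (f : TPlaq P k → ℝ) (p : TPlaq P 0) :
    QestarIter hd k f p =
      if offK k p.src p.μ + 1 = P.L ^ k ∧ offK k p.src p.ν + 1 = P.L ^ k then
        ((P.L : ℝ) ^ k) ^ 2 * f ⟨iterBlockOf k p.src, p.μ, p.ν, p.hμν⟩ else 0 := by
  obtain ⟨x, α, β, hαβ⟩ := p
  have hx := eq_blockSiteK hk x
  conv_lhs => rw [hx]
  exact QestarIter_blockSiteK hd hk f (iterBlockOf k x) _ hαβ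

/-! ## §2  The explicit potential and its curl -/

/-- one summand of the potential at the site `x`, bond direction `κ`, partner direction `μ` (`m = (L^k − 1)/2`):
`[μ < κ]·h_{μκ}(m − j_μ(x)) + [κ < μ]·[j_κ(x) = L^k − 1]·h_{κμ}·L^k·(j_μ(x) − m)`. [cite: BalabanImbrieJaffe1985, §7.3 p.326] -/
def potTerm (k : ℕ) (h : Fin P.d → Fin P.d → ℝ) (x : TSite P 0) (κ μ : Fin P.d) : ℝ :=
  (if μ < κ then h μ κ * ((((P.L : ℝ) ^ k - 1) / 2) - (offK k x μ : ℝ)) else 0) +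
    (if κ < μ then (if offK k x κ + 1 = P.L ^ k then
      h κ μ * (P.L : ℝ) ^ k * ((offK k x μ : ℝ) - ((P.L : ℝ) ^ k - 1) / 2) else 0) else 0)

/-- **THE EXPLICIT POTENTIAL** of `Q^{e*}_kh − h^η` (curl factor `c`): `A(⟨x, κ⟩) = c⁻¹Σ_μ potTerm k h x κ μ` — block-periodic, of size
`O(L^k·max|h|)`. [cite: BalabanImbrieJaffe1985, §7.3 p.326] -/
def potK (k : ℕ) (c : ℝ) (h : Fin P.d → Fin P.d → ℝ) : VecField P 0 ℝ :=
  fun b => c⁻¹ * ∑ μ : Fin P.d, potTerm k h b.src b.dir μ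

/-- The transverse difference of the `β`-components across an `α`-step, `α < β`: only the partner `μ = α` sees the step.
[cite: BalabanImbrieJaffe1985, §7.3 p.326] -/
theorem sum_potTerm_shift_sub {α β : Fin P.d} (hαβ : α < β) (h : Fin P.d → Fin P.d → ℝ) (x : TSite P 0) :
    ∑ μ, potTerm k h (x.shift α) β μ - ∑ μ, potTerm k h x β μ =
      -(h α β * ((offK k (x.shift α) α : ℝ) - offK k x α)) := by
  rw [← Finset.sum_sub_distrib, Finset.sum_eq_single α]
  · simp only [potTerm, if_pos hαβ, if_neg (lt_asymm hαβ), add_zero]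
    ring
  · intro μ _ hμ
    simp only [potTerm, offK_shift_of_ne x hμ, offK_shift_of_ne x (ne_of_gt hαβ)]
    exact sub_self _
  · intro h; exact absurd (Finset.mem_univ α) h

/-- The transverse difference of the `α`-components across a `β`-step, `α < β`: only the partner `μ = β` sees the step, and only on the
last `α`-layer of the block. [cite: BalabanImbrieJaffe1985, §7.3 p.326] -/
theorem sum_potTerm_sub_shift {α β : Fin P.d} (hαβ : α < β) (h : Fin P.d → Fin P.d → ℝ) (x : TSite P 0) :
    ∑ μ, potTerm k h x α μ - ∑ μ, potTerm k h (x.shift β) α μ =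
      -(if offK k x α + 1 = P.L ^ k then
          h α β * (P.L : ℝ) ^ k * ((offK k (x.shift β) β : ℝ) - offK k x β) else 0) := by
  rw [← Finset.sum_sub_distrib, Finset.sum_eq_single β]
  · simp only [potTerm, if_neg (lt_asymm hαβ), if_pos hαβ, zero_add, offK_shift_of_ne x (ne_of_lt hαβ)]
    split_ifs <;> ring
  · intro μ _ hμ
    simp only [potTerm, offK_shift_of_ne x hμ, offK_shift_of_ne x (ne_of_lt hαβ)]
    exact sub_self _
  · intro h; exact absurd (Finset.mem_univ β) h

/-- **THE CURL OF THE EXPLICIT POTENTIAL IS `Q^{e*}_kh − h^η`**: for every fine plaquette `p` of type `(αβ)`,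
`(∂_cA)(p) = (Q^{e*}_kh)(p) − h_{αβ}` (`= (L^{2k} − 1)h_{αβ}` on the junction plaquettes, `−h_{αβ}` elsewhere); `c ≠ 0`, `k ≤ m + K`, `2 ≤ d`.
[cite: BalabanImbrieJaffe1985, (4.2.6) p.311] -/
theorem curl_potK (hd : 2 ≤ P.d) (hk : k ≤ P.m + P.K) {c : ℝ} (hc : c ≠ 0) (h : Fin P.d → Fin P.d → ℝ) (p : TPlaq P 0) :
    curl c (potK k c h) p = QestarIter hd k (fun q : TPlaq P k => h q.μ q.ν) p - h p.μ p.ν := by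
  rw [QestarIter_apply_offK hd hk]
  obtain ⟨x, α, β, hαβ⟩ := p
  have hn : (0 : ℕ) < P.L ^ k := pow_pos P.L_pos k
  have ha := offK_lt k x α
  have hb := offK_lt k x β
  have e1 : curl c (potK k c h) ⟨x, α, β, hαβ⟩ =
      (∑ μ, potTerm k h x α μ - ∑ μ, potTerm k h (x.shift β) α μ) +
        (∑ μ, potTerm k h (x.shift α) β μ - ∑ μ, potTerm k h x β μ) := by
    simp only [curl, potK, smul_eq_mul]
    field_simp
    ring
  rw [e1, sum_potTerm_shift_sub hαβ, sum_potTerm_sub_shift hαβ, offK_shift_self hk x α, offK_shift_self hk x β]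
  dsimp only
  by_cases hA : offK k x α + 1 = P.L ^ k
  · have hA' : (offK k x α + 1) % P.L ^ k = 0 := by rw [hA, Nat.mod_self]
    rw [if_pos hA, hA']
    by_cases hB : offK k x β + 1 = P.L ^ k
    · have hB' : (offK k x β + 1) % P.L ^ k = 0 := by rw [hB, Nat.mod_self]
      rw [hB', if_pos ⟨hA, hB⟩]
      have eα : (offK k x α : ℝ) = (P.L : ℝ) ^ k - 1 := by
        rw [← Nat.cast_pow, ← hA]; push_cast; ring
      have eβ : (offK k x β : ℝ) = (P.L : ℝ) ^ k - 1 := by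
        rw [← Nat.cast_pow, ← hB]; push_cast; ring
      rw [Nat.cast_zero, eα, eβ]
      ring
    · have hB' : (offK k x β + 1) % P.L ^ k = offK k x β + 1 := Nat.mod_eq_of_lt (by omega)
      rw [hB', if_neg (fun h => hB h.2)]
      have eα : (offK k x α : ℝ) = (P.L : ℝ) ^ k - 1 := by
        rw [← Nat.cast_pow, ← hA]; push_cast; ring
      push_cast
      rw [eα]
      ring
  · have hA' : (offK k x α + 1) % P.L ^ k = offK k x α + 1 := Nat.mod_eq_of_lt (by omega)
    rw [if_neg hA, hA', if_neg (fun h => hA h.1)]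
    push_cast
    ring

/-! ## §3  The block averages of the potential vanish: `Q_kA = 0` -/

/-- Along a straight contour of `L^k` bonds exactly one bond starts on the last layer of a block:
`Σ_{t<L^k} [(a + t) mod L^k = L^k − 1] = 1` for `a < L^k`. [cite: Balaban1984PropagatorsI, (1.18) p.20] -/
theorem sum_range_ite_mod_eq_one {n a : ℕ} (ha : a < n) (r : ℝ) :
    ∑ t ∈ Finset.range n, (if (a + t) % n + 1 = n then r else 0) = r := by
  rw [Finset.sum_eq_single (n - 1 - a)]
  · rw [if_pos]
    rw [show a + (n - 1 - a) = n - 1 by omega, Nat.mod_eq_of_lt (by omega)]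
    omega
  · intro t ht hne
    rw [Finset.mem_range] at ht
    rw [if_neg]
    intro h
    by_cases hlt : a + t < n
    · rw [Nat.mod_eq_of_lt hlt] at h; omega
    · rw [Nat.mod_eq_sub_mod (by omega), Nat.mod_eq_of_lt (by omega)] at h; omega
  · intro h
    exact absurd (Finset.mem_range.2 (by omega)) h

/-- **The offsets are balanced on every block**: `Σ_{j ∈ {0,…,n−1}^d} (j_μ − (n−1)/2) = 0` (the reflection `j_μ ↦ n−1−j_μ`).
[cite: Balaban1984PropagatorsI, (1.18) p.20] -/
theorem sum_offset_sub_half_eq_zero (n d : ℕ) (μ : Fin d) :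
    ∑ j : Fin d → Fin n, (((j μ : ℕ) : ℝ) - ((n : ℝ) - 1) / 2) = 0 := by
  set e : (Fin d → Fin n) ≃ (Fin d → Fin n) :=
    Equiv.piCongrRight fun κ => if κ = μ then Fin.revPerm else Equiv.refl (Fin n) with he
  have hrefl : ∀ j : Fin d → Fin n, ((e j μ : ℕ) : ℝ) = (n : ℝ) - 1 - (j μ : ℕ) := fun j => by
    have h1 : e j μ = Fin.rev (j μ) := by simp [he, Equiv.piCongrRight_apply]
    rw [h1, Fin.val_rev, Nat.cast_sub (j μ).isLt]
    push_cast
    ring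
  have hsum := Fintype.sum_equiv e (fun j => (((e j μ : ℕ) : ℝ) - ((n : ℝ) - 1) / 2))
    (fun j => (((j μ : ℕ) : ℝ) - ((n : ℝ) - 1) / 2)) fun j => rfl
  simp only [hrefl] at hsum
  have h2 : 2 * ∑ j : Fin d → Fin n, (((j μ : ℕ) : ℝ) - ((n : ℝ) - 1) / 2) = 0 := by
    rw [two_mul]
    conv_lhs => congr; rw [← hsum]
    rw [← Finset.sum_add_distrib]
    exact Finset.sum_eq_zero fun j _ => by ring
  linarith

/-- **The straight-contour sums of the potential, summed over a block, vanish**: `Σ_{x∈B^k(y)} A([x, x + L^ke_κ]) = 0` for every unit bond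
`⟨y, κ⟩` (the offsets `j_μ`, `μ ≠ κ`, are constant along the contour and balanced over the block; the `κ`-layer indicator is met exactly once).
[cite: Balaban1984PropagatorsI, (1.18) p.20] -/
theorem sum_iterBlock_segSum_potK (hk : k ≤ P.m + P.K) (c : ℝ) (h : Fin P.d → Fin P.d → ℝ) (y : TSite P k) (κ : Fin P.d) :
    ∑ x ∈ iterBlock k y, segSum (potK k c h) x κ (P.L ^ k) = 0 := by
  -- the contour sum at a fixed starting point, offsets read at the starting point
  have hseg : ∀ x : TSite P 0, segSum (potK k c h) x κ (P.L ^ k) =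
      c⁻¹ * ∑ μ, ((P.L : ℝ) ^ k * (if μ < κ then h μ κ * ((((P.L : ℝ) ^ k - 1) / 2) - (offK k x μ : ℝ)) else 0) +
        (if κ < μ then h κ μ * (P.L : ℝ) ^ k * ((offK k x μ : ℝ) - ((P.L : ℝ) ^ k - 1) / 2) else 0)) := by
    intro x
    simp only [segSum, runBond, potK, ← Finset.mul_sum]
    congr 1
    rw [Finset.sum_comm]
    refine Finset.sum_congr rfl fun μ _ => ?_
    by_cases hμκ : μ = κ
    · subst hμκ
      simp only [potTerm, lt_irrefl, if_false, add_zero, Finset.sum_const_zero, mul_zero]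
    simp only [potTerm, offK_runSite_of_ne x hμκ, offK_runSite_self hk x κ, Finset.sum_add_distrib, Finset.sum_const,
      Finset.card_range, nsmul_eq_mul, Nat.cast_pow]
    congr 1
    by_cases hκμ : κ < μ
    · simp only [if_pos hκμ]
      exact sum_range_ite_mod_eq_one (offK_lt k x κ) _
    · simp only [if_neg hκμ, Finset.sum_const_zero]
  simp only [hseg, ← Finset.mul_sum]
  rw [sum_iterBlock_eq hk, Finset.sum_comm]
  refine mul_eq_zero_of_right _ (Finset.sum_eq_zero fun μ _ => ?_)
  simp only [offK_blockSiteK hk, Finset.sum_add_distrib]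
  have h0 := sum_offset_sub_half_eq_zero (P.L ^ k) P.d μ
  push_cast at h0
  have hneg : ∑ j : Fin P.d → Fin (P.L ^ k), ((((P.L : ℝ) ^ k - 1) / 2) - ((j μ : ℕ) : ℝ)) = 0 := by
    rw [← neg_eq_zero, ← Finset.sum_neg_distrib]; simpa only [neg_sub] using h0
  have hS1 : ∑ j : Fin P.d → Fin (P.L ^ k), (P.L : ℝ) ^ k *
      (if μ < κ then h μ κ * ((((P.L : ℝ) ^ k - 1) / 2) - ((j μ : ℕ) : ℝ)) else 0) = 0 := by
    by_cases h1 : μ < κ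
    · simp only [if_pos h1, ← Finset.mul_sum, hneg, mul_zero]
    · simp only [if_neg h1, mul_zero, Finset.sum_const_zero]
  have hS2 : ∑ j : Fin P.d → Fin (P.L ^ k),
      (if κ < μ then h κ μ * (P.L : ℝ) ^ k * (((j μ : ℕ) : ℝ) - ((P.L : ℝ) ^ k - 1) / 2) else 0) = 0 := by
    by_cases h2 : κ < μ
    · simp only [if_pos h2, ← Finset.mul_sum, h0, mul_zero]
    · simp only [if_neg h2, Finset.sum_const_zero]
  rw [hS1, hS2, add_zero]

/-- **`Q_kA = 0` for the explicit potential** ([12] (1.18): `(Q_kA)_b = L^{−k(d+1)}Σ_{x∈B^k(b₋)} A([x, x(b)])`, tree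
`B5Eq118OneStroke.bondAvgIter_eq_blockSum`). [cite: BalabanImbrieJaffe1985, (4.1.1) p.309] -/
theorem bondAvgIter_potK (hk : k ≤ P.m + P.K) (c : ℝ) (h : Fin P.d → Fin P.d → ℝ) : bondAvgIter k (potK k c h) = 0 := by
  funext b
  rw [bondAvgIter_eq_blockSum k hk, sum_iterBlock_segSum_potK hk, smul_zero, Pi.zero_apply]

/-- **A member of the domain `V` of (4.1.1) with curl `Q^{e*}_kh − h^η`**: the axial gauge fixing `A + ∂λ(A)` of the explicit potential
(p36/p37's (5.1.13): `Q_k` is unchanged, the result is `k`-fold axial) — so `Q^{e*}_kh − h^η ∈ ∂V`; `c ≠ 0`, `k ≤ m + K`, `2 ≤ d`.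
[cite: BalabanImbrieJaffe1985, (4.1.2) p.309] -/
theorem exists_V411_curl_eq (hd : 2 ≤ P.d) (hk : k ≤ P.m + P.K) {c : ℝ} (hc : c ≠ 0) (h : Fin P.d → Fin P.d → ℝ) :
    ∃ v : BondSpace P, v ∈ V411 P k ∧ ∀ p : TPlaq P 0,
      curl c ((toE P).symm v) p = QestarIter hd k (fun q : TPlaq P k => h q.μ q.ν) p - h p.μ p.ν := by
  set A : VecField P 0 ℝ := potK k c h + grad c (lamOf c k (potK k c h)) with hA
  refine ⟨toE P A, ?_, fun p => ?_⟩
  · rw [mem_V411, LinearEquiv.symm_apply_apply]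
    exact ⟨by rw [hA, bondAvgIter_add_grad_lamOf hk, bondAvgIter_potK hk], by rw [hA]; exact deltaAx_lamOf hc k hk _⟩
  · rw [LinearEquiv.symm_apply_apply, hA, Pi.add_def, curl_add, curl_grad, add_zero, curl_potK hd hk hc]

/-! ## §4  `h^η ⊥ ∂A`: the constant η-plaquette field is orthogonal to all curls -/

/-- The constant η-plaquette field `√w·h_{μν}` as a vector of the Euclidean space (the expected value of `resE` on a constant unit field).
[cite: BalabanImbrieJaffe1985, (4.2.6) p.311] -/
def constE (w : ℝ) (h : Fin P.d → Fin P.d → ℝ) : PlaqSpace P := WithLp.toLp 2 fun p => Real.sqrt w * h p.μ p.ν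

/-- Components of `constE`. [cite: BalabanImbrieJaffe1985, (4.2.6) p.311] -/
@[simp] theorem constE_apply (w : ℝ) (h : Fin P.d → Fin P.d → ℝ) (p : TPlaq P 0) :
    constE (P := P) w h p = Real.sqrt w * h p.μ p.ν := rfl

/-- shifting the base point of a plaquette along a fixed coordinate is a permutation of the plaquettes. [cite: BalabanImbrieJaffe1985, (4.1.1) p.309] -/
def plaqShift (sel : TPlaq P 0 → Fin P.d) (hsel : ∀ (x y : TSite P 0) (μ ν : Fin P.d) (hμν : μ < ν),
    sel ⟨x, μ, ν, hμν⟩ = sel ⟨y, μ, ν, hμν⟩) : TPlaq P 0 ≃ TPlaq P 0 where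
  toFun p := ⟨p.src.shift (sel p), p.μ, p.ν, p.hμν⟩
  invFun p := ⟨p.src.unshift (sel p), p.μ, p.ν, p.hμν⟩
  left_inv p := by
    obtain ⟨x, μ, ν, hμν⟩ := p
    simp only [hsel (x.shift _) x μ ν hμν, Site.unshift_shift]
  right_inv p := by
    obtain ⟨x, μ, ν, hμν⟩ := p
    simp only [hsel (x.unshift _) x μ ν hμν, Site.shift_unshift]

/-- **Discrete Stokes on the torus**: `Σ_p h_{μν(p)}·(∂_cA)(p) = 0` for every η-bond field `A` and every constant coefficient array `h`
(the four edge sums are translates of one another). [cite: BalabanImbrieJaffe1985, (4.1.1) p.309] -/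
theorem sum_const_mul_curl (c : ℝ) (h : Fin P.d → Fin P.d → ℝ) (A : VecField P 0 ℝ) :
    ∑ p : TPlaq P 0, h p.μ p.ν * curl c A p = 0 := by
  have e1 : ∀ p : TPlaq P 0, h p.μ p.ν * curl c A p =
      c * (h p.μ p.ν * A ⟨p.src, p.μ⟩ - h p.μ p.ν * A ⟨p.src.shift p.ν, p.μ⟩) +
        c * (h p.μ p.ν * A ⟨p.src.shift p.μ, p.ν⟩ - h p.μ p.ν * A ⟨p.src, p.ν⟩) := fun p => by
    simp only [curl, smul_eq_mul]; ring
  simp only [e1, Finset.sum_add_distrib, ← Finset.mul_sum, Finset.sum_sub_distrib]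
  have hν := Equiv.sum_comp (plaqShift (P := P) (fun p => p.ν) fun _ _ _ _ _ => rfl)
    (fun p : TPlaq P 0 => h p.μ p.ν * A ⟨p.src, p.μ⟩)
  have hμ := Equiv.sum_comp (plaqShift (P := P) (fun p => p.μ) fun _ _ _ _ _ => rfl)
    (fun p : TPlaq P 0 => h p.μ p.ν * A ⟨p.src, p.ν⟩)
  simp only [plaqShift, Equiv.coe_fn_mk] at hν hμ
  rw [hν, hμ, sub_self, sub_self, mul_zero, add_zero]

/-- **`h^η ⊥ ∂A`** in the Euclidean encoding: `⟪constE w h, curlOp w c v⟫ = 0` for every `v`. [cite: BalabanImbrieJaffe1985, (4.2.6) p.311] -/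
theorem inner_constE_curlOp (w c : ℝ) (h : Fin P.d → Fin P.d → ℝ) (v : BondSpace P) :
    ⟪constE (P := P) w h, curlOp (P := P) w c v⟫ = 0 := by
  have hc : ∀ p : TPlaq P 0, curlOp (P := P) w c v p = Real.sqrt w * curl c ((toE P).symm v) p := fun p => rfl
  rw [PiLp.inner_apply]
  simp only [hc, constE_apply, RCLike.inner_apply, conj_trivial]
  have e1 : ∀ p : TPlaq P 0, Real.sqrt w * curl c ((toE P).symm v) p * (Real.sqrt w * h p.μ p.ν) =
      Real.sqrt w * Real.sqrt w * (h p.μ p.ν * curl c ((toE P).symm v) p) := fun p => by ring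
  simp only [e1, ← Finset.mul_sum, sum_const_mul_curl, mul_zero]

/-! ## §5  `resE(h) = √w·h^η` -/

/-- The orthogonal projection `∂G_{k,Ax}∂^*` kills vectors orthogonal to all curls of constraint fields. [cite: BalabanImbrieJaffe1985, §4.2 p.311] -/
theorem curlG_eq_zero_of_orthogonal {k : ℕ} (hk : k ≤ P.m + P.K) {c : ℝ} (hc : c ≠ 0) {w : ℝ} (hw : 0 < w) {y : PlaqSpace P}
    (hy : ∀ v : BondSpace P, ⟪y, curlOp (P := P) w c v⟫ = 0) : curlG (V411 P k) (curlOp (P := P) w c) y = 0 := by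
  have hD := hD_V411 hk hc hw
  rw [← inner_self_eq_zero (𝕜 := ℝ), curlG_symm hD]
  obtain ⟨v, hv⟩ := curlG_mem_range (V411 P k) (curlOp (P := P) w c) (curlG (V411 P k) (curlOp (P := P) w c) y)
  rw [hv]
  exact hy _

/-- **`∂G_{k,Ax}∂^*Q^{e*}_kh = Q^{e*}_kh − h^η`** (Euclidean encoding): the projection of `Q^{e*}_kh` onto `∂V` is `Q^{e*}_kh − √w·h^η`, because
the difference IS a curl of a constraint field (§3) and `h^η ⊥ ∂V` (§4); `k ≤ m + K`, `2 ≤ d`, `w > 0`, `c ≠ 0`.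
[cite: BalabanImbrieJaffe1985, (4.2.6) p.311] -/
theorem curlG_QesOp_const (hd : 2 ≤ P.d) (hk : k ≤ P.m + P.K) {c : ℝ} (hc : c ≠ 0) {w : ℝ} (hw : 0 < w)
    (h : Fin P.d → Fin P.d → ℝ) :
    curlG (V411 P k) (curlOp (P := P) w c) (QesOp (P := P) hd w k (toU P k fun q => h q.μ q.ν)) =
      QesOp (P := P) hd w k (toU P k fun q => h q.μ q.ν) - constE w h := by
  obtain ⟨v, hv, hcurl⟩ := exists_V411_curl_eq hd hk hc h
  have hX : QesOp (P := P) hd w k (toU P k fun q => h q.μ q.ν) = curlOp (P := P) w c v + constE w h := by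
    ext p
    rw [PiLp.add_apply, QesOp_apply, constE_apply, show curlOp (P := P) w c v p = Real.sqrt w * curl c ((toE P).symm v) p from rfl,
      hcurl, ← mul_add, sub_add_cancel]
    rfl
  rw [hX, map_add, curlG_eq_zero_of_orthogonal hk hc hw (inner_constE_curlOp w c h), add_zero, add_sub_cancel_right]
  exact curlG_apply_curl (hD_V411 hk hc hw) ⟨v, hv⟩

/-- **THE RESIDUAL FIELD OF A CONSTANT UNIT FIELD IS THE CONSTANT η-FIELD**: `resE(h) = √w·h^η`, i.e. `f_k(p) = h_{μν}` on every fine plaquette of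
type `(μν)` for the unit field `f(p′) = h_{μν(p′)}` ((4.2.6) = (5.2.12) on the flux part); `k ≤ m + K`, `2 ≤ d`, `w > 0`, `c ≠ 0`.
[cite: BalabanImbrieJaffe1985, (4.2.6) p.311] -/
theorem resE_const (hd : 2 ≤ P.d) (hk : k ≤ P.m + P.K) {c : ℝ} (hc : c ≠ 0) {w : ℝ} (hw : 0 < w) (h : Fin P.d → Fin P.d → ℝ) :
    resE hd w c k (toU P k fun q => h q.μ q.ν) = constE w h := by
  rw [resE, curlG_QesOp_const hd hk hc hw, sub_sub_cancel]

/-- **`|f_k(h)(p)| ≤ max|h|`** in the Euclidean encoding: `|resE(h)(p)| ≤ √w·s` whenever `|h_{μν}| ≤ s`. [cite: BalabanImbrieJaffe1985, (7.3.2) p.326] -/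
theorem abs_resE_const_le (hd : 2 ≤ P.d) (hk : k ≤ P.m + P.K) {c : ℝ} (hc : c ≠ 0) {w : ℝ} (hw : 0 < w)
    {h : Fin P.d → Fin P.d → ℝ} {s : ℝ} (hs : ∀ μ ν, |h μ ν| ≤ s) (p : TPlaq P 0) :
    |resE hd w c k (toU P k fun q => h q.μ q.ν) p| ≤ Real.sqrt w * s := by
  rw [resE_const hd hk hc hw, constE_apply, abs_mul, abs_of_nonneg (Real.sqrt_nonneg w)]
  exact mul_le_mul_of_nonneg_left (hs _ _) (Real.sqrt_nonneg w)

end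

end Literature.MathematicalPhysics.QuantumFieldTheory.BalabanImbrieJaffe1984to88.BIJ85ResidualConstants
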